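import Summits.NavierStokesRegularity.NavierStokesRegularity.Theorems.FrozenSignCascadeBoundedEnvelopeContinuationOfLiouville
import Summits.NavierStokesRegularity.NavierStokesRegularity.Theorems.FrozenSignCascadeBoundedEnvelopeContinuationPMPairing
import HarnessLib

/-!
# Route FrozenSignCascade · crux `BoundedEnvelopeContinuation` (stmt-NavierStokesRegularity-10579)
# from the pseudo-measure Liouville statement (L_PM) — reshape r4 of the line `registered`

Helper file for the crux item (conjunct (B) of route `FrozenSignCascade`); lands `--supports` that
item and proves the registered stub `stub_ofLiouvillePM` of the reshaped skeleton (lead c4).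

**Reshape r4 (lead c4).** The KNSS record-zoom limit of the line (lead c2: `stub_recordSequence`,
`stub_zoomLimitMorrey`, `stub_nearFinalPersistence`) inherits from the flow not only the
scale-invariant MORREY bound of its slices (the shadow used by reshape r3 and its open stub
(L_M)), but the full critical PSEUDO-MEASURE bound `u(t) ∈ PM²` in its dual form
`|∫ u_l φ| ≤ C ∫ ‖𝓕φ‖/‖ξ‖²` (Le Jan–Sznitman / Cannone–Karch): the dual bound follows from the
envelope by the self-adjointness of `𝓕` (`pm_dual_of_envelope`), is translation invariant and
critical under the zooms with constant `C/ν` (`pm_dual_zoom`), and passes to the bounded pointwise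
limit (`pm_dual_of_tendsto`). Hence (B) follows from the WEAKER Liouville statement

  (L_PM)  a bounded ancient mild solution `v` (`ν = 1`), jointly smooth and Oseen-mild on
          `(-∞,0) × ℝ³`, with the Morrey bound `∫_{B_r(y)} ‖v t‖² ≤ M' r` at all radii AND the
          dual pseudo-measure bound `|∫ v_l(t) φ| ≤ C' ∫ ‖𝓕φ‖/‖ξ‖²` at all negative times,
          vanishes identically,

which is the honest residue of the line: it carries ALL the structure hypothesis (B) supplies to
the zoom limit. (L_M) ⇒ (L_PM) trivially (`liouvillePM_of_liouvilleMorrey`), so every landed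
bridge into (L_M) — (L) (p154353), `¬ LocalTypeISingularityExists` (p156854), the small-constant
regime (p160131) and the axisymmetric class (p165977/p166240) — is a bridge into (L_PM).

`boundedEnvelopeContinuation_of_liouvillePM` is lead c2's composition
(`boundedEnvelopeContinuation_of_liouvilleMorrey`, file `…OfLiouville.lean`) with the three
`PM²` steps inserted before the contradiction.

References: G. Koch, N. Nadirashvili, G. Seregin, V. Šverák, Acta Math. 203 (2009) =
arXiv:0709.3599, Lemma 6.1, Prop. 4.1, §6; P. G. Lemarié-Rieusset, *The Navier–Stokes problem in
the 21st century* (2016), §8.5, Thm. 15.1; M. Cannone, G. Karch, J. Differential Equations 197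
(2004), §2; T. Barker, C. Prange, Arch. Ration. Mech. Anal. 235 (2020), §1.3.
-/

noncomputable section

set_option linter.dupNamespace false -- nested layout Summit.<S>.<Sub>, Sub = S (D-0017)

open Set MeasureTheory Filter Topology Metric Function
open scoped ENNReal FourierTransform
open Literature.Analysis Literature.Analysis.FluidPDE Literature.Analysis.FluidPDE.FourierNS

namespace Summit.NavierStokesRegularity.NavierStokesRegularity.Theorems.BoundedEnvelope

/-- **Crux (B) of route `FrozenSignCascade` from the pseudo-measure Liouville statement (L_PM)**
(statement and proof in the module docstring): lead c2's record-zoom composition with the `PM²`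
inheritance of lead c4 (`pm_dual_of_envelope`, `pm_dual_zoom`, `pm_dual_of_tendsto`).
[cite: KochNadirashviliSereginSverak2009, Lemma 6.1 and Prop. 4.1 (arXiv:0709.3599); LemarieRieusset2016, §8.5 and Thm. 15.1 (C)] -/
theorem boundedEnvelopeContinuation_of_liouvillePM
    (hLPM : (∀ v : ℝ → EuclideanSpace ℝ (Fin 3) → EuclideanSpace ℝ (Fin 3),
      Literature.Analysis.FluidPDE.IsBoundedAncientMildSolution 1 v →
      ContDiffOn ℝ (⊤ : ℕ∞) (uncurry v) (Set.Iio 0 ×ˢ Set.univ) →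
      (∀ s t : ℝ, s < t → t < 0 → ∀ x,
        v t x = UnboundedOperators.heatExtension (v s) (t - s) x -
          Literature.Analysis.FluidPDE.oseenDuhamel 1 s v v t x) →
      (∃ M' : ℝ, ∀ t < 0, ∀ (y : EuclideanSpace ℝ (Fin 3)) (r : ℝ), 0 < r →
        ∫ x in Metric.ball y r, ‖v t x‖ ^ 2 ≤ M' * r) →
      (∃ C' : ℝ, ∀ t < 0, ∀ (l : Fin 3) (φ : EuclideanSpace ℝ (Fin 3) → ℝ),
        MeasureTheory.Integrable φ →
        MeasureTheory.Integrable (fun ξ : EuclideanSpace ℝ (Fin 3) =>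
          ‖FourierTransform.fourier (fun x => (φ x : ℂ)) ξ‖ / ‖ξ‖ ^ 2) →
        |∫ y, v t y l * φ y| ≤
          C' * ∫ ξ : EuclideanSpace ℝ (Fin 3), ‖FourierTransform.fourier (fun x => (φ x : ℂ)) ξ‖ / ‖ξ‖ ^ 2) →
      ∀ t < 0, ∀ x, v t x = 0)) :
    Summit.NavierStokesRegularity.NavierStokesRegularity.Theses.FrozenSignCascade.BoundedEnvelopeContinuation := by
  intro ν hν u₀ hu hd hdiv hbdd
  refine stub_clayOfBackwardBounded ν hν u₀ hu hd hdiv ?_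
  intro T hT u p hsol hLH hu0 x₀
  -- the classical Leray–Hopf solution is a Kato solution on `[0, T)`
  have hLH' : IsLerayHopfOn T ν 0 (u 0) u := by rw [hu0]; exact hLH
  have hd0 : HasRapidSpatialDecay (u 0) := by rw [hu0]; exact hd
  have hK : IsKatoSolutionOn T ν u₀ u := by
    have h := isKatoSolutionOn_of_classical hν hT hsol hLH' hd0
    rwa [hu0] at h
  -- the envelope constant at horizon `T` and the Morrey constant
  obtain ⟨C, hC⟩ := hbdd T hT
  obtain ⟨κ, _, hMor⟩ := stub_morreyOfEnvelope
  -- Tao-class states with Fourier side on `[0, Tt]`, `Tt < T`, identified with `u`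
  have hstate : ∀ Tt : ℝ, 0 < Tt → Tt < T →
      ∃ (u' : ℝ → EuclideanSpace ℝ (Fin 3) → EuclideanSpace ℝ (Fin 3))
        (p' : ℝ → EuclideanSpace ℝ (Fin 3) → ℝ) (V : ℝ → EuclideanSpace ℝ (Fin 3) → Fin 3 → ℂ),
        IsTaoSolutionOn Tt ν u₀ u' p' ∧ IsFourierMild (4 * Real.pi ^ 2 * ν) 4 0 Tt V ∧
        (∀ t ∈ Icc 0 Tt, u' t = synthVel (V t)) ∧ V 0 = fourierData hu hd ∧
        ∀ t ∈ Icc 0 Tt, u' t = u t := by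
    intro Tt hTt0 hTtT
    obtain ⟨u', p', V, hTao, hV, hsyn, hV0⟩ :=
      stub_stateOfKato ν hν u₀ hu hd hdiv T u hK Tt hTt0 hTtT
    refine ⟨u', p', V, hTao, hV, hsyn, hV0, fun t htI => ?_⟩
    have hae : u' t =ᵐ[volume] u t :=
      hTao.ae_eq_of_kato_Icc hν hTt0 (hK.mild.mono (Ico_subset_Ico_right hTtT.le))
        (hK.continuousInLpOn.mono fun s hs => ⟨hs.1, lt_of_le_of_lt hs.2 hTtT⟩)
        (hK.aestronglyMeasurable.mono_measure (Measure.restrict_mono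
          (Set.prod_mono (Ioo_subset_Ioo_right hTtT.le) Subset.rfl) le_rfl)) t htI
    exact (Continuous.ae_eq_iff_eq volume (hTao.classical.contDiff_velocity htI).continuous
      (hsol.contDiff_velocity ⟨htI.1, lt_of_le_of_lt htI.2 hTtT⟩).continuous).1 hae
  -- boundedness of `u` on closed sub-slabs
  have hbd : ∀ t < T, ∃ B : ℝ, ∀ s ∈ Icc 0 t, ∀ x, ‖u s x‖ ≤ B := by
    intro t htT
    set Tt : ℝ := (max t 0 + T) / 2 with hTt
    have hTt0 : 0 < Tt := by
      rw [hTt]; linarith [le_max_right t 0]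
    have hTtT : Tt < T := by
      rw [hTt]
      have : max t 0 < T := max_lt htT hT
      linarith
    have htTt : t ≤ Tt := by
      rw [hTt]
      have : max t 0 < T := max_lt htT hT
      linarith [le_max_left t 0]
    obtain ⟨u', p', V, hTao, -, -, -, heq⟩ := hstate Tt hTt0 hTtT
    obtain ⟨B, -, hB⟩ := hTao.exists_bound_velocity
    refine ⟨B, fun s hs x => ?_⟩
    rw [← heq s ⟨hs.1, hs.2.trans htTt⟩]
    exact hB s ⟨hs.1, hs.2.trans htTt⟩ x
  -- the Morrey bound on every slice `0 < t < T`
  have hMorrey : ∀ t ∈ Ioo 0 T, ∀ (x₁ : EuclideanSpace ℝ (Fin 3)) (r : ℝ), 0 < r → 17 * r ≤ 1 →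
      ∫ x in ball x₁ r, ‖u t x‖ ^ 2 ≤ κ * C ^ 2 * r := by
    intro t ht x₁ r hr _
    set Tt : ℝ := (t + T) / 2 with hTt
    have hTt0 : 0 < Tt := by rw [hTt]; linarith [ht.1, ht.2]
    have htTt : t < Tt := by rw [hTt]; linarith [ht.2]
    have hTtT : Tt < T := by rw [hTt]; linarith [ht.2]
    obtain ⟨u', p', V, hTao, hV, hsyn, hV0, heq⟩ := hstate Tt hTt0 hTtT
    have htI : t ∈ Icc 0 Tt := ⟨ht.1.le, htTt.le⟩
    have henv : ∀ ξ : EuclideanSpace ℝ (Fin 3), ‖ξ‖ ^ 2 * ‖V t ξ‖ ≤ C :=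
      fun ξ => hC Tt hTtT.le V hV hV0 t htI ξ
    have hC0 : 0 ≤ C := le_trans (by positivity) (henv 0)
    have hdecV : ∀ K : ℕ, ∃ B, HasDecay K B (V t) := fun K => by
      obtain ⟨B, hB⟩ := hV.decay K
      exact ⟨B, hB t⟩
    have hm := hMor C (V t) hC0 (hV.continuous_slice t) hdecV (fun ξ l => hV.conjSymm t ξ l) henv
      x₁ r hr
    rw [← heq t htI, hsyn t htI]
    exact hm
  -- suppose `(T, x₀)` were not backward bounded: record points, zooms, the ancient limit
  by_contra hnot
  have hcont : ContinuousOn (uncurry u) (Ico 0 T ×ˢ univ) := hsol.smooth_velocity.continuousOn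
  obtain ⟨tc, xc, Λ, e, htc, he, hte, hΛ, hΛeq, hdom, hΛlim, hprod⟩ :=
    stub_recordSequence T hT u hcont hbd x₀ hnot
  obtain ⟨z, hz⟩ : ∃ z : ℕ → ℝ → EuclideanSpace ℝ (Fin 3) → EuclideanSpace ℝ (Fin 3),
      ∀ n s y, z n s y = (Λ n)⁻¹ • u (tc n + ν / Λ n ^ 2 * s) (xc n + (ν / Λ n) • y) :=
    ⟨fun n s y => (Λ n)⁻¹ • u (tc n + ν / Λ n ^ 2 * s) (xc n + (ν / Λ n) • y), fun _ _ _ => rfl⟩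
  obtain ⟨s₀, hs₀, hpers⟩ := stub_nearFinalPersistence ν T hν hT u p hsol hLH' tc xc Λ e htc he hte
    hΛ hΛeq hdom hprod z hz
  obtain ⟨φ, v, hφ, hpt, hmild, hsm, hoseen, hMv⟩ := stub_zoomLimitMorrey ν T hν hT u p hsol hLH'
    (κ * C ^ 2) hMorrey tc xc Λ e htc he hte hΛ hdom hΛlim hprod z hz
  -- the limit is nonzero at `(s₀, 0)` …
  have hlow : (1 / 2 : ℝ) ≤ ‖v s₀ 0‖ :=
    ge_of_tendsto ((hpt s₀ hs₀ 0).norm) ((hφ.tendsto_atTop).eventually hpers)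
  -- … inherits the dual `PM²` bound with constant `C/ν` at every negative time …
  have hPMu : ∀ t ∈ Ioo 0 T, ∀ (l : Fin 3) (ψ : EuclideanSpace ℝ (Fin 3) → ℝ), Integrable ψ →
      Integrable (fun ξ : EuclideanSpace ℝ (Fin 3) => ‖𝓕 (fun x => (ψ x : ℂ)) ξ‖ / ‖ξ‖ ^ 2) →
      |∫ x, u t x l * ψ x| ≤ C * ∫ ξ : EuclideanSpace ℝ (Fin 3), ‖𝓕 (fun x => (ψ x : ℂ)) ξ‖ / ‖ξ‖ ^ 2 := by
    intro t ht l ψ hψ hJ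
    set Tt : ℝ := (t + T) / 2 with hTt
    have hTt0 : 0 < Tt := by rw [hTt]; linarith [ht.1, ht.2]
    have htTt : t < Tt := by rw [hTt]; linarith [ht.2]
    have hTtT : Tt < T := by rw [hTt]; linarith [ht.2]
    obtain ⟨u', p', V, hTao, hV, hsyn, hV0, heq⟩ := hstate Tt hTt0 hTtT
    have htI : t ∈ Icc 0 Tt := ⟨ht.1.le, htTt.le⟩
    have henv : ∀ ξ : EuclideanSpace ℝ (Fin 3), ‖ξ‖ ^ 2 * ‖V t ξ‖ ≤ C :=
      fun ξ => hC Tt hTtT.le V hV hV0 t htI ξ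
    have hdecV : ∀ K : ℕ, ∃ B, HasDecay K B (V t) := fun K => by
      obtain ⟨B, hB⟩ := hV.decay K
      exact ⟨B, hB t⟩
    rw [← heq t htI, hsyn t htI]
    exact pm_dual_of_envelope C (V t) (hV.continuous_slice t) hdecV henv l ψ hψ hJ
  have hPMv : ∀ s < 0, ∀ (l : Fin 3) (ψ : EuclideanSpace ℝ (Fin 3) → ℝ), Integrable ψ →
      Integrable (fun ξ : EuclideanSpace ℝ (Fin 3) => ‖𝓕 (fun x => (ψ x : ℂ)) ξ‖ / ‖ξ‖ ^ 2) →
      |∫ y, v s y l * ψ y| ≤ C / ν * ∫ ξ : EuclideanSpace ℝ (Fin 3), ‖𝓕 (fun x => (ψ x : ℂ)) ξ‖ / ‖ξ‖ ^ 2 := by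
    intro s hs
    -- eventually the zoom time `tc n + ν s / Λ n²` lies in `(0, T)`
    have hev : ∀ᶠ n in atTop, tc (φ n) + ν / Λ (φ n) ^ 2 * s ∈ Ioo 0 T := by
      have h1 : Tendsto (fun n => tc (φ n) * Λ (φ n) ^ 2) atTop atTop :=
        hprod.comp hφ.tendsto_atTop
      filter_upwards [h1.eventually_gt_atTop (-(ν * s))] with n hn
      have hΛ0 : 0 < Λ (φ n) := hΛ (φ n)
      have hΛ2 : 0 < Λ (φ n) ^ 2 := by positivity
      constructor
      · have : 0 < tc (φ n) * Λ (φ n) ^ 2 + ν * s := by linarith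
        have key : tc (φ n) + ν / Λ (φ n) ^ 2 * s = (tc (φ n) * Λ (φ n) ^ 2 + ν * s) / Λ (φ n) ^ 2 := by
          field_simp
        rw [key]; positivity
      · have : ν / Λ (φ n) ^ 2 * s < 0 :=
          mul_neg_of_pos_of_neg (div_pos hν (pow_pos (hΛ (φ n)) 2)) hs
        linarith [hte (φ n), he (φ n)]
    refine pm_dual_of_tendsto (z := fun n => z (φ n) s) (hpt s hs) ?_ ?_ ?_
    · filter_upwards [hev] with n hn
      have hcu : Continuous (u (tc (φ n) + ν / Λ (φ n) ^ 2 * s)) :=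
        (hsol.contDiff_velocity ⟨hn.1.le, hn.2⟩).continuous
      have hz' : z (φ n) s = fun y => (Λ (φ n))⁻¹ • u (tc (φ n) + ν / Λ (φ n) ^ 2 * s)
          (xc (φ n) + (ν / Λ (φ n)) • y) := funext fun y => hz (φ n) s y
      rw [hz']
      have hlin : Continuous fun y : EuclideanSpace ℝ (Fin 3) => xc (φ n) + (ν / Λ (φ n)) • y :=
        continuous_const.add (continuous_const_smul (ν / Λ (φ n)))
      exact ((hcu.comp hlin).const_smul ((Λ (φ n))⁻¹)).aestronglyMeasurable
    · filter_upwards [hev] with n hn y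
      rw [hz (φ n) s y, norm_smul, Real.norm_of_nonneg (inv_nonneg.2 (hΛ (φ n)).le)]
      have hsI : tc (φ n) + ν / Λ (φ n) ^ 2 * s ∈ Icc 0 (tc (φ n) + e (φ n)) := by
        refine ⟨hn.1.le, ?_⟩
        have : ν / Λ (φ n) ^ 2 * s < 0 :=
          mul_neg_of_pos_of_neg (div_pos hν (pow_pos (hΛ (φ n)) 2)) hs
        linarith [(he (φ n)).le]
      have hb := hdom (φ n) _ hsI (xc (φ n) + (ν / Λ (φ n)) • y)
      have hΛ0 : Λ (φ n) ≠ 0 := (hΛ (φ n)).ne'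
      calc (Λ (φ n))⁻¹ * ‖u (tc (φ n) + ν / Λ (φ n) ^ 2 * s) (xc (φ n) + (ν / Λ (φ n)) • y)‖
          ≤ (Λ (φ n))⁻¹ * (2 * Λ (φ n)) :=
            mul_le_mul_of_nonneg_left hb (inv_nonneg.2 (hΛ (φ n)).le)
        _ = 2 := by field_simp
    · filter_upwards [hev] with n hn l ψ hψ hJ
      have hz' : (fun y => z (φ n) s y l * ψ y) = fun y =>
          ((Λ (φ n))⁻¹ • u (tc (φ n) + ν / Λ (φ n) ^ 2 * s) (xc (φ n) + (ν / Λ (φ n)) • y)) l * ψ y :=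
        funext fun y => by rw [hz (φ n) s y]
      rw [hz']
      have key := pm_dual_zoom (u := u (tc (φ n) + ν / Λ (φ n) ^ 2 * s)) (C := C)
        (hPMu _ hn) (inv_nonneg.2 (hΛ (φ n)).le) (div_pos hν (hΛ (φ n))) (xc (φ n)) l hψ hJ
      have hΛ0 : Λ (φ n) ≠ 0 := (hΛ (φ n)).ne'
      have hconst : (Λ (φ n))⁻¹ / (ν / Λ (φ n)) * C = C / ν := by
        field_simp
      rwa [hconst] at key
  -- … and is zero by (L_PM)
  have hzero : v s₀ 0 = 0 := hLPM v hmild hsm hoseen hMv ⟨C / ν, hPMv⟩ s₀ hs₀ 0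
  rw [hzero, norm_zero] at hlow
  norm_num at hlow
/-- **(L_M) ⇒ (L_PM)**: the pseudo-measure Liouville statement has one more hypothesis than the
Morrey–Liouville statement (L_M) of reshape r3, so it is implied by it (and hence by (L), by
`¬ LocalTypeISingularityExists`, and it holds in the small-constant and axisymmetric regimes).
[folklore] -/
theorem liouvillePM_of_liouvilleMorrey
    (hLM : ∀ v : ℝ → EuclideanSpace ℝ (Fin 3) → EuclideanSpace ℝ (Fin 3),
      IsBoundedAncientMildSolution 1 v →
      ContDiffOn ℝ (⊤ : ℕ∞) (uncurry v) (Set.Iio 0 ×ˢ Set.univ) →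
      (∀ s t : ℝ, s < t → t < 0 → ∀ x,
        v t x = UnboundedOperators.heatExtension (v s) (t - s) x - oseenDuhamel 1 s v v t x) →
      (∃ M' : ℝ, ∀ t < 0, ∀ (y : EuclideanSpace ℝ (Fin 3)) (r : ℝ), 0 < r →
        ∫ x in Metric.ball y r, ‖v t x‖ ^ 2 ≤ M' * r) →
      ∀ t < 0, ∀ x, v t x = 0) :
    (∀ v : ℝ → EuclideanSpace ℝ (Fin 3) → EuclideanSpace ℝ (Fin 3),
      Literature.Analysis.FluidPDE.IsBoundedAncientMildSolution 1 v →
      ContDiffOn ℝ (⊤ : ℕ∞) (uncurry v) (Set.Iio 0 ×ˢ Set.univ) →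
      (∀ s t : ℝ, s < t → t < 0 → ∀ x,
        v t x = UnboundedOperators.heatExtension (v s) (t - s) x -
          Literature.Analysis.FluidPDE.oseenDuhamel 1 s v v t x) →
      (∃ M' : ℝ, ∀ t < 0, ∀ (y : EuclideanSpace ℝ (Fin 3)) (r : ℝ), 0 < r →
        ∫ x in Metric.ball y r, ‖v t x‖ ^ 2 ≤ M' * r) →
      (∃ C' : ℝ, ∀ t < 0, ∀ (l : Fin 3) (φ : EuclideanSpace ℝ (Fin 3) → ℝ),
        MeasureTheory.Integrable φ →
        MeasureTheory.Integrable (fun ξ : EuclideanSpace ℝ (Fin 3) =>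
          ‖FourierTransform.fourier (fun x => (φ x : ℂ)) ξ‖ / ‖ξ‖ ^ 2) →
        |∫ y, v t y l * φ y| ≤
          C' * ∫ ξ : EuclideanSpace ℝ (Fin 3), ‖FourierTransform.fourier (fun x => (φ x : ℂ)) ξ‖ / ‖ξ‖ ^ 2) →
      ∀ t < 0, ∀ x, v t x = 0) :=
  fun v hv hsm hoseen hM _ => hLM v hv hsm hoseen hM

/-- **Registered stub `stub_ofLiouvillePM` of the reshaped skeleton (r4)**: the implication
(L_PM) ⇒ `BoundedEnvelopeContinuation`, by name, so that the skeleton's composition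
`BoundedEnvelopeContinuation_of := stub_ofLiouvillePM stub_liouvillePM` is closed modulo the
single open stub `stub_liouvillePM` (L_PM).
[cite: KochNadirashviliSereginSverak2009, Lemma 6.1 and Prop. 4.1 (arXiv:0709.3599)] -/
theorem stub_ofLiouvillePM :
    (∀ v : ℝ → EuclideanSpace ℝ (Fin 3) → EuclideanSpace ℝ (Fin 3),
      Literature.Analysis.FluidPDE.IsBoundedAncientMildSolution 1 v →
      ContDiffOn ℝ (⊤ : ℕ∞) (uncurry v) (Set.Iio 0 ×ˢ Set.univ) →
      (∀ s t : ℝ, s < t → t < 0 → ∀ x,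
        v t x = UnboundedOperators.heatExtension (v s) (t - s) x -
          Literature.Analysis.FluidPDE.oseenDuhamel 1 s v v t x) →
      (∃ M' : ℝ, ∀ t < 0, ∀ (y : EuclideanSpace ℝ (Fin 3)) (r : ℝ), 0 < r →
        ∫ x in Metric.ball y r, ‖v t x‖ ^ 2 ≤ M' * r) →
      (∃ C' : ℝ, ∀ t < 0, ∀ (l : Fin 3) (φ : EuclideanSpace ℝ (Fin 3) → ℝ),
        MeasureTheory.Integrable φ →
        MeasureTheory.Integrable (fun ξ : EuclideanSpace ℝ (Fin 3) =>
          ‖FourierTransform.fourier (fun x => (φ x : ℂ)) ξ‖ / ‖ξ‖ ^ 2) →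
        |∫ y, v t y l * φ y| ≤
          C' * ∫ ξ : EuclideanSpace ℝ (Fin 3), ‖FourierTransform.fourier (fun x => (φ x : ℂ)) ξ‖ / ‖ξ‖ ^ 2) →
      ∀ t < 0, ∀ x, v t x = 0) →
    Summit.NavierStokesRegularity.NavierStokesRegularity.Theses.FrozenSignCascade.BoundedEnvelopeContinuation :=
  boundedEnvelopeContinuation_of_liouvillePM

end Summit.NavierStokesRegularity.NavierStokesRegularity.Theorems.BoundedEnvelope

end
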